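import Literature.MathematicalPhysics.QuantumFieldTheory.Balaban1983to89.B6Prop23OneScaleTorus
import Literature.MathematicalPhysics.QuantumFieldTheory.Balaban1983to89.B6RandomWalk
import Literature.MathematicalPhysics.QuantumFieldTheory.Balaban1983to89.B6Lemma21Arith
import Literature.MathematicalPhysics.QuantumFieldTheory.Balaban1983to89.B4Sect5Torus

/-!
# `Balaban1983to89.B6Lemma21OneScaleTorus` — T. Bałaban, *Propagators and renormalization transformations for lattice
# gauge theories. II*, Commun. Math. Phys. **96** (1984) 223–250 [Balaban1984PropagatorsII], Lemma 2.1 p.234: the VERBATIM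
# `B6.Lemma21Printed` HOLDS on the one-scale torus family — the one-scale complement of the cell's multi-scale refutation

statement-level skeleton of published theorems with citation tags; proofs where landed; nothing here is a claim about the Yang–Mills mass gap

PDF held: `paper:balaban1984-cmp96-propagators-rt-ii` (journal page = PDF page + 222); pp. 233–235 [PDF 11–13] read.

CITATION HEADER (lean-in-tree rule).  WHAT IS REPRODUCED: lit-balaban SKELETON row **B6.Lem2.1** (Lemma 2.1 (2.60)–(2.63),
p. 234), verbatim: *"For the numbers α, 0 < α < 1, c₁(α) = 12c₀^d(½α), and RM satisfying (2.59) we have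
e^{−αδ₀d(y,y′)} ≤ e^{−αδ₀RM max{|j−j′|−1,0}}, y ∈ Λ_j, y′ ∈ Λ_{j′}, (2.60)  sup_{y∈𝔅} Σ_{y′∈𝔅} e^{−αδ₀d(y,y′)} ≤ c₁(α), (2.61)
hence … ≤ c₁(α)^n (2.62) and … ≤ c₁(α)^n e^{−(1−α)δ₀d(y,y′)}. (2.63)"*, together with p. 235: *"If we have one scale, i.e.
Λ_k = T₁^{(k)}, then the operator is a unit lattice operator"*.  The cell's record of this Lemma (row B6.Lem2.1, head
`refuted-as-printed (+proved repaired ON TOWERS)`, ref-4 g13): the VERBATIM typed statement `B6.Lemma21Printed` is REFUTED on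
MULTI-scale families — d = 2 every δ₀ > 0 (`B6Lemma21TwoDimRefutation.not_lemma21Printed_planar`,
`B6Lemma21TwoDim.not_lemma21Printed_d2`, `B6Lemma21TowerD2.not_lemma21Printed_tower`), d = 4
(`B6Lemma21Counterexample.printed_c1_exceeded`) — because the count (2.58) loses one separation factor on the last leg of
(2.47); and it is REPAIRED with larger constants (`B6Lemma21Repaired`, `B6Lemma21TwoScale`, unconditional on towers
`B6TowerDecomp.lemma21TwoScale_towers`).  THIS FILE records the complementary fact: **on ONE scale the printed statement is
TRUE with the printed constant** — there are no surfaces Σ_j, no decomposition (2.47), and (2.61) is the elementary lattice sum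
Σ_{y′∈T₁^{(k)}} e^{−αδ₀|y−y′|₁} ≤ c₀(α)^{d} ≤ c₀(½α)^{d} ≤ 12c₀(½α)^{d} = c₁(α) (the paper's own count at m = 0), while (2.60)
is void (j = j′).  It is proved HYPOTHESIS-FREE (every δ₀ > 0, every dimension d + 1, every L, every scale k, every period
vector, every M, R) on EXACTLY the family `B6Prop23OneScaleTorus.oneScaleTorusGeo` (seat p01 g5, p253194) on which the
verbatim Proposition 2.3 is inhabited by the genuine operator — so on that family Lemma 2.1 ∧ Prop. 2.3 hold jointly and
genuinely (`lemma21_and_prop23_oneScaleTorus`).  Unit `lit-balaban-r03` (B6 reader/owner, gen 6; own lineage on Lemma 2.1: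
`B6Lemma21TowerD2` p243508), PHASE 2 (G.1 model instance), HOME `run/shared/lean/pub/lit-balaban/`, 2026-08-21.
IMPORTS `…B6Prop23OneScaleTorus` (the family, `torusL1`), `…B6RandomWalk` (`lemma21Printed_iff`, `lemma21_full`,
`Ineq260…263`, `Triangle254`), `…B6Lemma21Arith` (`summable_c0_term`), `…B4Sect5Torus` (`circAbs_add_le`) — BY NAME; no new
definition, no new named fact (theorems only).

## Content (sorry-free; `[cite: …]` tags are TEXT LOCATIONS; the mathematics is `[folklore]` lattice-sum bookkeeping)

* §1 `torusL1_add_le`, `triangle254_oneScaleTorus`: the periodic ℓ¹ distance (2.46)-on-one-scale satisfies the triangle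
  inequality (2.54) (coordinatewise `B4Sect5Torus.circAbs_add_le`, by name).
* §2 `sum_exp_circAbs_le_c0`: `Σ_{j∈ℤ/N} e^{−αδ₀·dist(a−j, Nℤ)} ≤ c₀(α) = Σ_{z∈ℤ} e^{−αδ₀|z|}` (centred representatives inject
  into ℤ); `c0_le_c0_half`: `c₀(α) ≤ c₀(½α)`; `sum_exp_torusL1_le`: `Σ_{y′∈T} e^{−αδ₀|y−y′|₁} ≤ c₀(α)^{d+1}` (product over
  coordinates).
* §3 **`ineq260_oneScaleTorus`, `ineq261_oneScaleTorus`, `lemma21Printed_oneScaleTorus`** (the verbatim `B6.Lemma21Printed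
  (d+1) δ₀` on the family, every δ₀ > 0), **`lemma21_full_oneScaleTorus`** (all four displays (2.60)–(2.63) by
  `B6RandomWalk.lemma21_full`), `exists_cond259` / `lemma21_oneScaleTorus_nonvacuous` ((2.59) is met by members of the family, so
  the conclusions are asserted, not vacuous), `lemma21_and_prop23_oneScaleTorus`.

## Honest scope

(i) ONE SCALE ONLY (k levels = 1): the multi-scale Lemma 2.1 as printed stays refuted; this file does not touch the repaired
versions.  (ii) Site version of 𝔅 (the printed (2.61) sums over sites y′ ∈ 𝔅); on p01's bond geometry
`B6Cor28OneScaleTorus.oneScaleBondGeo` the same sum acquires a factor d + 1 (bond directions) and the printed constant is NOT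
claimed there.  (iii) Value = kernel certificate of bookkeeping for a located, asserted statement of [Balaban1984PropagatorsII] on
a model family; NOT summit progress, NOT continuum, NOT Clay.
-/

open Finset

namespace Literature.MathematicalPhysics.QuantumFieldTheory.Balaban1983to89.B6Lemma21OneScaleTorus

open Literature.MathematicalPhysics.QuantumFieldTheory.Balaban1983to89.B4TorusKernel.MultiPeriod (circAbs circAbs_nonneg
  centre abs_add_mul_centre)
open Literature.MathematicalPhysics.QuantumFieldTheory.Balaban1983to89.B4Sect5Torus (circAbs_add_le)
open Literature.MathematicalPhysics.QuantumFieldTheory.Balaban1983to89.B5QGGQ145Bounds (Idx toZ)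
open Literature.MathematicalPhysics.QuantumFieldTheory.Balaban1983to89.B6Prop23OneScaleTorus (torusL1 oneScaleTorusGeo
  Index torusCinv prop23Printed_oneScaleTorus)
open Literature.MathematicalPhysics.QuantumFieldTheory.Balaban1983to89.B6RandomWalk (Ineq260 Ineq261 Ineq262 Ineq263
  Triangle254 lemma21Printed_iff lemma21_full)
open Literature.MathematicalPhysics.QuantumFieldTheory.Balaban1983to89.B6Lemma21Arith (summable_c0_term)

noncomputable section

variable {d : ℕ}

/-! ## §1. The periodic ℓ¹ distance satisfies the triangle inequality (2.54) -/

/-- `0 ≤ |x|_{T,1}`. [folklore] -/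
private theorem torusL1_nonneg (N : Fin (d + 1) → ℕ) (hN : ∀ i, 1 ≤ N i) (x : Fin (d + 1) → ℤ) : 0 ≤ torusL1 N x := by
  unfold torusL1
  exact Finset.sum_nonneg fun i _ => by exact_mod_cast circAbs_nonneg (hN i) (x i)

/-- the triangle inequality of the periodic ℓ¹ distance: `|x + y|_{T,1} ≤ |x|_{T,1} + |y|_{T,1}` — (2.54) for the one-scale
distance (2.46). [cite: Balaban1984PropagatorsII, (2.54) p.233, (2.46) p.231] [folklore] -/
theorem torusL1_add_le (N : Fin (d + 1) → ℕ) (hN : ∀ i, 1 ≤ N i) (x y : Fin (d + 1) → ℤ) :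
    torusL1 N (x + y) ≤ torusL1 N x + torusL1 N y := by
  unfold torusL1
  rw [← Finset.sum_add_distrib]
  exact Finset.sum_le_sum fun i _ => by exact_mod_cast circAbs_add_le (hN i) (x i) (y i)

/-- **(2.54) on the one-scale torus**: the distance `d(y, y′) = |y − y′|_{T,1}` of the family
`B6Prop23OneScaleTorus.oneScaleTorusGeo` satisfies the triangle inequality (`B6RandomWalk.Triangle254`).
[cite: Balaban1984PropagatorsII, (2.54) p.233 «This is of course the triangle inequality for our distance»] [folklore] -/
theorem triangle254_oneScaleTorus (L : ℕ) (k : ℕ) (N : Fin (d + 1) → ℕ+) (M R : ℕ) :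
    Triangle254 (oneScaleTorusGeo d L k N M R) := by
  intro a b c
  show torusL1 (fun i => (N i : ℕ)) (toZ a - toZ c)
    ≤ torusL1 (fun i => (N i : ℕ)) (toZ a - toZ b) + torusL1 (fun i => (N i : ℕ)) (toZ b - toZ c)
  have h := torusL1_add_le (fun i => (N i : ℕ)) (fun i => (N i).pos) (toZ a - toZ b) (toZ b - toZ c)
  rwa [sub_add_sub_cancel] at h

/-! ## §2. The lattice sums: `Σ_{ℤ/N} e^{−αδ₀ dist} ≤ c₀(α)`, `c₀(α) ≤ c₀(½α)`, `Σ_T e^{−αδ₀|·|₁} ≤ c₀(α)^{d+1}` -/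

/-- **`Σ_{j ∈ ℤ/N} e^{−αδ₀·dist(a − j, Nℤ)} ≤ c₀(α) = Σ_{z∈ℤ} e^{−αδ₀|z|}`**: the centred representatives of the classes
`a − j` are pairwise distinct integers `z_j` with `|z_j| = dist(a − j, Nℤ)`. [cite: Balaban1984PropagatorsII, p.233 (the count behind (2.58) at m = 0: c₀(α) = Σ_{z∈ℤ}e^{−αδ₀|z|})] [folklore] -/
theorem sum_exp_circAbs_le_c0 {N : ℕ} (hN : 1 ≤ N) {δ₀ α : ℝ} (h : 0 < α * δ₀) (a : ℤ) :
    ∑ j : Fin N, Real.exp (-(α * δ₀ * ((circAbs N (a - ((j : ℕ) : ℤ)) : ℤ) : ℝ))) ≤ B6.c0 δ₀ α := by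
  set e : Fin N → ℤ := fun j => (a - ((j : ℕ) : ℤ)) + N * centre N (a - ((j : ℕ) : ℤ)) with he
  have hinj : Function.Injective e := by
    intro j j' hjj'
    have hj : (((j : ℕ) : ℤ)) % (N : ℤ) = ((j : ℕ) : ℤ) :=
      Int.emod_eq_of_lt (by positivity) (by exact_mod_cast j.isLt)
    have hj' : (((j' : ℕ) : ℤ)) % (N : ℤ) = ((j' : ℕ) : ℤ) :=
      Int.emod_eq_of_lt (by positivity) (by exact_mod_cast j'.isLt)
    have hrel : ((j' : ℕ) : ℤ) = ((j : ℕ) : ℤ) +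
        (N : ℤ) * (centre N (a - ((j' : ℕ) : ℤ)) - centre N (a - ((j : ℕ) : ℤ))) := by
      have h1 : e j = e j' := hjj'
      simp only [he] at h1
      linarith
    have hmod : (((j' : ℕ) : ℤ)) % (N : ℤ) = (((j : ℕ) : ℤ)) % (N : ℤ) := by
      rw [hrel, Int.add_mul_emod_self_left]
    rw [hj, hj'] at hmod
    exact Fin.ext (by exact_mod_cast hmod.symm)
  have hg : Summable (fun z : ℤ => Real.exp (-(α * δ₀ * |(z : ℝ)|))) := summable_c0_term h
  have hf : Summable (fun j : Fin N => Real.exp (-(α * δ₀ * ((circAbs N (a - ((j : ℕ) : ℤ)) : ℤ) : ℝ)))) :=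
    (hasSum_fintype _).summable
  have hle : ∀ j : Fin N, Real.exp (-(α * δ₀ * ((circAbs N (a - ((j : ℕ) : ℤ)) : ℤ) : ℝ)))
      ≤ Real.exp (-(α * δ₀ * |((e j : ℤ) : ℝ)|)) := by
    intro j
    have hz : ((circAbs N (a - ((j : ℕ) : ℤ)) : ℤ) : ℝ) = |((e j : ℤ) : ℝ)| := by
      rw [← Int.cast_abs, abs_add_mul_centre hN]
    rw [hz]
  calc ∑ j : Fin N, Real.exp (-(α * δ₀ * ((circAbs N (a - ((j : ℕ) : ℤ)) : ℤ) : ℝ)))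
      = ∑' j : Fin N, Real.exp (-(α * δ₀ * ((circAbs N (a - ((j : ℕ) : ℤ)) : ℤ) : ℝ))) := (tsum_fintype _).symm
    _ ≤ ∑' z : ℤ, Real.exp (-(α * δ₀ * |(z : ℝ)|)) :=
        Summable.tsum_le_tsum_of_inj e hinj (fun c _ => (Real.exp_pos _).le) hle hf hg
    _ = B6.c0 δ₀ α := rfl

/-- `c₀(α) ≤ c₀(½α)` (termwise `e^{−αδ₀|z|} ≤ e^{−½αδ₀|z|}`), `c₀(α) = Σ_{z∈ℤ}e^{−αδ₀|z|}` of p.233.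
[cite: Balaban1984PropagatorsII, p.233 (c₀(α) definition)] [folklore] -/
theorem c0_le_c0_half {δ₀ α : ℝ} (h : 0 < α * δ₀) : B6.c0 δ₀ α ≤ B6.c0 δ₀ (α / 2) := by
  have h2 : 0 < α / 2 * δ₀ := by linarith
  unfold B6.c0
  refine Summable.tsum_le_tsum (fun z => ?_) (summable_c0_term h) (summable_c0_term h2)
  apply Real.exp_le_exp.mpr
  have hz : 0 ≤ |(z : ℝ)| := abs_nonneg _
  nlinarith

/-- `0 ≤ c₀`. [folklore] -/
private theorem c0_nonneg (δ₀ α : ℝ) : 0 ≤ B6.c0 δ₀ α := by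
  unfold B6.c0
  exact tsum_nonneg fun z => (Real.exp_pos _).le

/-- **`Σ_{y′ ∈ T} e^{−αδ₀|y − y′|_{T,1}} ≤ c₀(α)^{d+1}`** on the unit torus `T = Π_μ ℤ/N_μ`: the exponential of the ℓ¹ distance
factorises over the `d + 1` coordinates and each factor is the sum of `sum_exp_circAbs_le_c0`.
[cite: Balaban1984PropagatorsII, (2.61) p.234, count p.233] [folklore] -/
theorem sum_exp_torusL1_le (N : Fin (d + 1) → ℕ) (hN : ∀ i, 1 ≤ N i) {δ₀ α : ℝ} (h : 0 < α * δ₀) (y : Idx N) :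
    ∑ y' : Idx N, Real.exp (-(α * δ₀ * torusL1 N (toZ y - toZ y'))) ≤ B6.c0 δ₀ α ^ (d + 1) := by
  set F : (i : Fin (d + 1)) → Fin (N i) → ℝ :=
    fun i j => Real.exp (-(α * δ₀ * ((circAbs (N i) (((y i : ℕ) : ℤ) - ((j : ℕ) : ℤ)) : ℤ) : ℝ))) with hF
  have hfac : ∀ y' : Idx N, Real.exp (-(α * δ₀ * torusL1 N (toZ y - toZ y'))) = ∏ i, F i (y' i) := by
    intro y'
    simp only [hF]
    rw [← Real.exp_sum]
    congr 1
    unfold torusL1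
    rw [Finset.mul_sum, ← Finset.sum_neg_distrib]
    rfl
  rw [Finset.sum_congr rfl fun y' _ => hfac y', ← Fintype.prod_sum F]
  have hc : B6.c0 δ₀ α ^ (d + 1) = ∏ _i : Fin (d + 1), B6.c0 δ₀ α := by
    rw [Finset.prod_const, Finset.card_univ, Fintype.card_fin]
  rw [hc]
  refine Finset.prod_le_prod (fun i _ => Finset.sum_nonneg fun j _ => (Real.exp_pos _).le) fun i _ => ?_
  exact sum_exp_circAbs_le_c0 (hN i) h _

/-! ## §3. Lemma 2.1, verbatim, on the one-scale torus family -/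

section Family

variable (d) (L : ℕ)

/-- **(2.60) on one scale is void**: all sites of `Λ_k = T₁^{(k)}` are at scale k, so `max{|j − j′| − 1, 0} = 0` and the
right side of (2.60) is `1 ≥ e^{−αδ₀d(y,y′)}` (`αδ₀ ≥ 0`). [cite: Balaban1984PropagatorsII, Lemma 2.1 (2.60) p.234] [folklore] -/
theorem ineq260_oneScaleTorus (k : ℕ) (N : Fin (d + 1) → ℕ+) (M R : ℕ) {δ₀ α : ℝ} (h : 0 ≤ α * δ₀) :
    Ineq260 (oneScaleTorusGeo d L k N M R) δ₀ α := by
  intro y y'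
  show Real.exp (-(α * δ₀ * torusL1 (fun i => (N i : ℕ)) (toZ y - toZ y')))
    ≤ Real.exp (-(α * δ₀ * (R : ℝ) * (M : ℝ) * max (|((k : ℕ) : ℝ) - ((k : ℕ) : ℝ)| - 1) 0))
  have h0 : max (|((k : ℕ) : ℝ) - ((k : ℕ) : ℝ)| - 1) 0 = 0 := by
    rw [sub_self, abs_zero, zero_sub]
    exact max_eq_right (by norm_num)
  rw [h0, mul_zero, neg_zero, Real.exp_zero]
  apply Real.exp_le_one_iff.mpr
  have hd := torusL1_nonneg (fun i => (N i : ℕ)) (fun i => (N i).pos) (toZ y - toZ y')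
  nlinarith

/-- **(2.61) on one scale WITH THE PRINTED CONSTANT**: `Σ_{y′∈T₁^{(k)}} e^{−αδ₀d(y,y′)} ≤ c₀(α)^{d+1} ≤ c₀(½α)^{d+1} ≤
12c₀(½α)^{d+1} = c₁(α)` for every y (d(y,y′) = |y − y′|_{T,1}, `αδ₀ > 0`). [cite: Balaban1984PropagatorsII, Lemma 2.1 (2.61) p.234] [folklore] -/
theorem ineq261_oneScaleTorus (k : ℕ) (N : Fin (d + 1) → ℕ+) (M R : ℕ) {δ₀ α : ℝ} (h : 0 < α * δ₀) :
    Ineq261 (d + 1) (oneScaleTorusGeo d L k N M R) δ₀ α := by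
  intro y
  show ∑ y' : Idx (fun i => (N i : ℕ)), Real.exp (-(α * δ₀ * torusL1 (fun i => (N i : ℕ)) (toZ y - toZ y')))
    ≤ B6.c1 (d + 1) δ₀ α
  have hc := c0_nonneg δ₀ α
  calc ∑ y' : Idx (fun i => (N i : ℕ)), Real.exp (-(α * δ₀ * torusL1 (fun i => (N i : ℕ)) (toZ y - toZ y')))
      ≤ B6.c0 δ₀ α ^ (d + 1) := sum_exp_torusL1_le (fun i => (N i : ℕ)) (fun i => (N i).pos) h y
    _ ≤ B6.c0 δ₀ (α / 2) ^ (d + 1) := pow_le_pow_left₀ hc (c0_le_c0_half h) _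
    _ ≤ 12 * B6.c0 δ₀ (α / 2) ^ (d + 1) :=
        le_mul_of_one_le_left (pow_nonneg (c0_nonneg δ₀ (α / 2)) _) (by norm_num)
    _ = B6.c1 (d + 1) δ₀ α := rfl

/-- **LEMMA 2.1, VERBATIM (`B6.Lemma21Printed`), ON EVERY FAMILY OF ONE-SCALE TORI, WITH NO HYPOTHESIS BUT `δ₀ > 0`**: for
every dimension d + 1, every L and every map `i ↦ (k_i, N_i, M_i, R_i)` the census Prop — (2.60) ∧ (2.61) with the PRINTED
`c₁(α) = 12c₀(½α)^{d+1}`, for all `0 < α < 1` under (2.59) — holds for the one-scale tori `Λ_{k_i} = Π_μ ℤ/N_{i,μ}` with the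
distance (2.46) (= periodic ℓ¹ distance on one scale).  ((2.59) is not even used: on one scale (2.61) holds for every α, δ₀ > 0.)
[cite: Balaban1984PropagatorsII, Lemma 2.1 (2.60)–(2.61) p.234; p.235 «If we have one scale, i.e. Λ_k = T₁^{(k)}»] -/
theorem lemma21Printed_oneScaleTorus_family {I : Type} (k : I → ℕ) (N : I → Fin (d + 1) → ℕ+) (M R : I → ℕ) {δ₀ : ℝ}
    (hδ₀ : 0 < δ₀) : B6.Lemma21Printed (d + 1) δ₀ (fun i : I => oneScaleTorusGeo d L (k i) (N i) (M i) (R i)) := by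
  rw [lemma21Printed_iff]
  intro i _ α hα0 _ _
  have h : 0 < α * δ₀ := mul_pos hα0 hδ₀
  exact ⟨ineq260_oneScaleTorus d L (k i) (N i) (M i) (R i) h.le, ineq261_oneScaleTorus d L (k i) (N i) (M i) (R i) h⟩

/-- **LEMMA 2.1, VERBATIM, ON p01's ONE-SCALE TORUS FAMILY `B6Prop23OneScaleTorus.Index`** (all scales k, all period vectors,
all M, R, all a ∈ [a₋, a₊]) — the SAME family on which `B6Prop23OneScaleTorus.prop23Printed_oneScaleTorus` inhabits the verbatim
Proposition 2.3. [cite: Balaban1984PropagatorsII, Lemma 2.1 (2.60)–(2.61) p.234] -/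
theorem lemma21Printed_oneScaleTorus {aminus aplus δ₀ : ℝ} (hδ₀ : 0 < δ₀) :
    B6.Lemma21Printed (d + 1) δ₀ (fun i : Index d aminus aplus => oneScaleTorusGeo d L i.k i.N i.M i.R) :=
  lemma21Printed_oneScaleTorus_family d L (fun i : Index d aminus aplus => i.k) (fun i => i.N) (fun i => i.M)
    (fun i => i.R) hδ₀

/-- **ALL FOUR DISPLAYS (2.60)–(2.63) on the one-scale torus family** (the chains (2.62), (2.63) through the cell's
`B6RandomWalk.lemma21_full`, which needs only (2.61) and the triangle inequality (2.54) = `triangle254_oneScaleTorus`).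
[cite: Balaban1984PropagatorsII, Lemma 2.1 (2.60)–(2.63) p.234] -/
theorem lemma21_full_oneScaleTorus {aminus aplus δ₀ : ℝ} (hδ₀ : 0 < δ₀) (i : Index d aminus aplus) {α : ℝ}
    (hα0 : 0 < α) (hα1 : α < 1) (h259 : B6.Cond259 (d + 1) δ₀ α (i.R : ℝ) (i.M : ℝ)) :
    Ineq260 (oneScaleTorusGeo d L i.k i.N i.M i.R) δ₀ α ∧ Ineq261 (d + 1) (oneScaleTorusGeo d L i.k i.N i.M i.R) δ₀ α ∧
      Ineq262 (d + 1) (oneScaleTorusGeo d L i.k i.N i.M i.R) δ₀ α ∧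
      Ineq263 (d + 1) (oneScaleTorusGeo d L i.k i.N i.M i.R) δ₀ α :=
  lemma21_full (d + 1) δ₀ hδ₀.le (fun i : Index d aminus aplus => oneScaleTorusGeo d L i.k i.N i.M i.R)
    (fun i => triangle254_oneScaleTorus L i.k i.N i.M i.R) (lemma21Printed_oneScaleTorus d L hδ₀) i trivial α hα0 hα1 h259

/-- **(2.59) is met on the family**: for every `α, δ₀ > 0` and every dimension parameter there is an `R` such that (2.59)
`¼αδ₀RM > 2d′ log c₀(½α) + 1` holds for every `M ≥ 1` — so the conclusions above are asserted for members of the family, not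
vacuously. [cite: Balaban1984PropagatorsII, (2.59) p.233 «Now we require that RM is sufficiently large»] [folklore] -/
theorem exists_cond259 (d' : ℕ) {δ₀ α : ℝ} (h : 0 < α * δ₀) :
    ∃ R : ℕ, ∀ M : ℕ, 1 ≤ M → B6.Cond259 d' δ₀ α (R : ℝ) (M : ℝ) := by
  obtain ⟨R, hR⟩ := exists_nat_gt ((2 * (d' : ℝ) * Real.log (B6.c0 δ₀ (α / 2)) + 1) * 4 / (α * δ₀))
  refine ⟨R, fun M hM => ?_⟩
  unfold B6.Cond259
  have hM' : (1 : ℝ) ≤ (M : ℝ) := by exact_mod_cast hM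
  have hR0 : (0 : ℝ) ≤ (R : ℝ) := Nat.cast_nonneg R
  have h1 : 2 * (d' : ℝ) * Real.log (B6.c0 δ₀ (α / 2)) + 1 < 1 / 4 * α * δ₀ * (R : ℝ) := by
    have h2 := (div_lt_iff₀ h).mp hR
    nlinarith
  calc 2 * (d' : ℝ) * Real.log (B6.c0 δ₀ (α / 2)) + 1 < 1 / 4 * α * δ₀ * (R : ℝ) := h1
    _ ≤ 1 / 4 * α * δ₀ * (R : ℝ) * (M : ℝ) :=
        le_mul_of_one_le_right (mul_nonneg (by nlinarith) hR0) hM'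

/-- **Non-vacuity on p01's family**: for every window `a₋ ≤ a₊`, every scale k, every period vector, every `M ≥ 1` and all
`α, δ₀ > 0` there is a member `i` (with that k, N, M) satisfying the hypotheses `Hyp21_22` and (2.59) of `B6.Lemma21Printed`.
[cite: Balaban1984PropagatorsII, (2.59) p.233, Lemma 2.1 p.234] [folklore] -/
theorem lemma21_oneScaleTorus_nonvacuous {aminus aplus : ℝ} (hwin : aminus ≤ aplus) (k : ℕ) (N : Fin (d + 1) → ℕ+)
    {M : ℕ} (hM : 1 ≤ M) {δ₀ α : ℝ} (h : 0 < α * δ₀) :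
    ∃ i : Index d aminus aplus, i.k = k ∧ i.N = N ∧ i.M = M ∧
      (oneScaleTorusGeo d L i.k i.N i.M i.R).Hyp21_22 ∧
      B6.Cond259 (d + 1) δ₀ α (oneScaleTorusGeo d L i.k i.N i.M i.R).R (oneScaleTorusGeo d L i.k i.N i.M i.R).M := by
  obtain ⟨R, hR⟩ := exists_cond259 (d + 1) h
  exact ⟨⟨k, N, M, R, aminus, le_refl _, hwin⟩, rfl, rfl, rfl, trivial, hR M hM⟩

/-- **LEMMA 2.1 ∧ PROPOSITION 2.3, BOTH VERBATIM, JOINTLY ON ONE FAMILY**: on p01's one-scale torus family the census Props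
`B6.Lemma21Printed (d+1) δ₀` (this file, every δ₀ > 0) and `B6.Prop23Printed (d+1)` (p253194, the genuine kernel of
`(Q′_kG′_k²Q′_k*)⁻¹`) hold together — two conjuncts of `B6.StatedBlock` inhabited genuinely on the same geometry family.
[cite: Balaban1984PropagatorsII, Lemma 2.1 p.234, Prop. 2.3 (2.86)–(2.87) p.238] -/
theorem lemma21_and_prop23_oneScaleTorus [NeZero L] {aminus aplus δ₀ : ℝ} (ha : 0 < aminus) (hδ₀ : 0 < δ₀) :
    B6.Lemma21Printed (d + 1) δ₀ (fun i : Index d aminus aplus => oneScaleTorusGeo d L i.k i.N i.M i.R) ∧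
      B6.Prop23Printed (d + 1) (fun i : Index d aminus aplus => oneScaleTorusGeo d L i.k i.N i.M i.R)
        (fun i => torusCinv d L i.k i.N i.M i.R i.a) :=
  ⟨lemma21Printed_oneScaleTorus d L hδ₀, prop23Printed_oneScaleTorus d L ha⟩

end Family

end

end Literature.MathematicalPhysics.QuantumFieldTheory.Balaban1983to89.B6Lemma21OneScaleTorus
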